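import Summits.BirchSwinnertonDyer.BirchSwinnertonDyer.Theorems.GenusKolyvaginAtTwoOffCutResidualAtTwoRLw2PhantomExclusionWitness
import Summits.BirchSwinnertonDyer.BirchSwinnertonDyer.Theorems.GenusKolyvaginAtTwoEquivariantKolyvaginExactAtTwoSelmerConditionVisible
import Literature.NumberTheory.EllipticCurves.HeegnerPointsKolyvaginGoodReductionProofs
import Literature.NumberTheory.EllipticCurves.ModularityVersionApProofs
import Literature.NumberTheory.EllipticCurves.BSDConductorProofs
import Literature.NumberTheory.EllipticCurves.HeegnerPointsKolyvaginClassesPointsProofs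
import HarnessLib

/-!
# Route `GenusKolyvaginAtTwo`, residual `OffCutResidualAtTwoR` (stmt-BirchSwinnertonDyer-31767), LINE 26 «lw2_phantom_exclusion»:
# THE DICHOTOMY — on the route's frame, `(NPh_M)` for every `M ≥ 1` ⟺ the level-2 Lawson–Wuthrich class is NOT a 2-SELMER class of
# `E/K`; equivalently, the genus engine's displayed hypothesis FAILS exactly when `res_K ξ ∈ Sel₂(E/K)`

Width seat `bsd-line-gk2-p4` g31 (cell `bsd-f1-sign2`), `--supports stmt-BirchSwinnertonDyer-31767 --as helper`.  THEOREMS ONLY (no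
definition, no named fact, no `sorry`).  **BSD is NOT proved by this file; nothing is closed by it alone.**

WHAT.  `…Lw2PhantomExclusionWitness` (p781093): `(NPh_M)(W, K) ∀ M ≥ 1` ⟺ at some place `w₀ ∋ 2N` of `K` the non-zero classes of `H¹(K, E[2])`
dying on `Γ_{K(E[4])}` — i.e. the single class `res_K ξ` (`…KLW` rigidity) — fail the Kummer condition.  This file removes the place: a class
of `H¹(K, E[2])` dying on `Γ_{K(E[4])}` is AUTOMATICALLY Kummer at every place NOT over `2N` —
* `mem_selmerLocalKer_of_forall_torsionFixing_four_of_notMem` — finite `w ∤ 2N`: `E_K` has good reduction at `w` (`N_E ∉ w ∩ ℤ`;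
  `hasGoodReductionAt_of_natCast_conductorNorm_notMem` + Literature `hasGoodReductionAt_baseChange_of_hasGoodReductionAt_rat`), inertia at
  `w ∤ 2` fixes `E[4]` (Néron–Ogg–Shafarevich, gk2-p3 `SelmerDescent.inertia_le_torsionFixing_of_hasGoodReductionAt`), so the lift `ι_{1→2} z`
  vanishes on inertia, which IS the Selmer condition at a good `w ∤ 4` (`SelmerDescent.mem_selmerLocalKer_iff_forall_h1Eval_eq_zero`); descend the
  level (`RelaxedCount.torsionH1OfDvd_mem_selmerLocalKer_iff_mem`);
* infinite `w`: `K_w ≅ ℂ`, every class is Kummer (Literature `mem_selmerLocalKer_infinitePlace_of_isImaginaryQuadratic`);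
* `mem_selmerGroup_iff_forall_mem_two_mul` — hence such a class is in `Sel₂(E_K/K)` iff it is Kummer at the places over `2N`;
* ★ `nonPhantom_pow_iff_resTorsion_notMem_selmerGroup` — **on the frame (`ρ_{E,2^n}` onto over `ℚ`; `K` imaginary quadratic, `d_K` odd,
  `d_K·(−|Δ|)`, `d_K·(−2|Δ|)` non-squares): `(NPh_M)(W, K)` for every `M ≥ 1` ⟺ `res_K x ∉ Sel₂(E_K/K)` for every non-zero `x ∈ H¹(ℚ, E[2])`
  dying on `Γ_{ℚ(E[4])}`** (there is exactly one such `x`, g10's `ξ`; `existsUnique_…`).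
READING for the planners (no claim about any curve is added): the obstruction to EVERY `(NPh)`-fed Kolyvagin argument at `2` on this route is
precisely «the Lawson–Wuthrich class is a `2`-Selmer class of `E` over the Heegner field» — Gross's restriction-injectivity question at `p = 2`
(Question 11 / McCallum's `H¹(K(E[2^k])/K, E[2^k]) ≠ 0`) made exact: `Sel₂(E_K) → H¹(K(E[4]), E[2])` is injective iff `(NPh)` holds.  On LINE 26's
«no witness» cells this says `res_K ξ ∈ Sel₂(E_K)` at every frame; those cells belong to NPh-free mechanisms (LINES 27/28).  BSD is NOT proved by
any of this.

References: [LawsonWuthrich2016] §3, §7.1, §8; [GrossLMS1991] §7 (7.1), (7.4), §9 Prop. 9.1; [McCallumLMS1991] §3, §4; [SilvermanAEC2009] VII.4.1,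
X.4.4; [MilneADT2006] I Prop. 3.8.
-/

set_option autoImplicit false
-- the Theorems namespace of this sub repeats the summit name by design (D-0017 nested layout)
set_option linter.dupNamespace false

noncomputable section

open scoped Classical NumberField

namespace Summit.BirchSwinnertonDyer.BirchSwinnertonDyer.Theorems.GenusExact.Lw2PhantomExclusion

open WeierstrassCurve NumberField Field IsDedekindDomain
open Literature.NumberTheory.EllipticCurves Literature.NumberTheory.GaloisRepresentations
open Summit.BirchSwinnertonDyer.BirchSwinnertonDyer.Theorems.KolyvaginLowerBoundAtTwo (torsionFixing_le_of_dvd)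
open Rat.HeightOneSpectrum (primesEquiv)

variable (W : WeierstrassCurve ℚ) [W.IsElliptic] {K : Type} [Field K] [NumberField K]

/-! ## §1 Off `2N` a class dying on `Γ_{K(E[4])}` is Kummer -/

/-- **Good reduction of `E/ℚ` at a place `u ∌ N_E`** (the prime under `u` does not divide the conductor; `dvd_conductorNorm_iff`; the statement of
`hasGoodReductionAt_of_conductorNorm_notMem` of the Eisenstein-primes files, re-derived to keep the imports inside the route). [cite: DiamondShurman2005, §8.3] -/
theorem hasGoodReductionAt_of_natCast_conductorNorm_notMem (u : HeightOneSpectrum (𝓞 ℚ))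
    (hu : ((W.conductorNorm ℤ : ℕ) : 𝓞 ℚ) ∉ u.asIdeal) : W.HasGoodReductionAt u := by
  haveI := Fact.mk (primesEquiv u).2
  have hℓu : ((primesEquiv u : ℕ) : 𝓞 ℚ) ∈ u.asIdeal :=
    (natCast_mem_asIdeal_iff_eq_primesEquiv_symm u (primesEquiv u).2).mpr (by rw [Subtype.coe_eta, Equiv.symm_apply_apply])
  by_contra hbad
  obtain ⟨c, hc⟩ := (W.dvd_conductorNorm_iff u).mpr hbad
  apply hu
  rw [hc, Nat.cast_mul]
  exact u.asIdeal.mul_mem_right _ hℓu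

/-- ★ **Off `2N`, a class of `H¹(K, E_K[2])` dying on `Γ_{K(E_K[4])}` is Kummer.**  `E/ℚ` elliptic, `K` a number field, `w` a finite place of `K`
with `2N_E ∉ w`, `z ∈ H¹(K, E_K[2])` with `[z, ρ] = 0` for all `ρ ∈ Γ_{K(E_K[4])}`: `z ∈ selmerLocalKer_w`.  Proof: `E_K` has good reduction at `w`
(`N_E ∉ w ∩ ℤ`), `w ∤ 2`, so inertia at `w` fixes `E_K[4]` (Néron–Ogg–Shafarevich) and the lift `ι_{1→2} z ∈ H¹(K, E_K[4])` vanishes on it — the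
Selmer condition at a good `w ∤ 4` (Gross (7.1)/(7.4)) —, and the Selmer condition is level-stable.  No phantom is removed: this is why a
phantom class can only be detected at the places over `2N`. [cite: GrossLMS1991, §7 (7.1), (7.4)] [cite: SilvermanAEC2009, Prop. VII.4.1, Cor. X.4.4] -/
theorem mem_selmerLocalKer_of_forall_torsionFixing_four_of_notMem (w : HeightOneSpectrum (𝓞 K))
    (hw : ((2 * W.conductorNorm ℤ : ℕ) : 𝓞 K) ∉ w.asIdeal) {z : galH1Torsion (W.baseChange K) (2 : ℤ)}
    (hz : ∀ ρ ∈ torsionFixing (W.baseChange K) (4 : ℤ), h1Eval (W.baseChange K) (2 : ℤ) z ρ = 0) :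
    z ∈ selmerLocalKer (W.baseChange K) (w.adicCompletion K) (2 : ℤ) := by
  haveI : (W.baseChange K).IsElliptic := inferInstanceAs (W.map (algebraMap ℚ K)).IsElliptic
  set v : HeightOneSpectrum (𝓞 ℚ) := w.under (𝓞 ℚ) with hvdef
  haveI : w.asIdeal.LiesOver v.asIdeal := ⟨rfl⟩
  -- `2 ∉ w`, `N ∉ w ∩ ℤ`
  have h2w : ((2 : ℕ) : 𝓞 K) ∉ w.asIdeal := fun h ↦ hw (by
    rw [Nat.cast_mul]; exact w.asIdeal.mul_mem_right _ h)
  have hNv : ((W.conductorNorm ℤ : ℕ) : 𝓞 ℚ) ∉ v.asIdeal := by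
    intro h
    apply hw
    have h' : algebraMap (𝓞 ℚ) (𝓞 K) ((W.conductorNorm ℤ : ℕ) : 𝓞 ℚ) ∈ w.asIdeal := by
      change ((W.conductorNorm ℤ : ℕ) : 𝓞 ℚ) ∈ w.asIdeal.under (𝓞 ℚ) at h
      rw [Ideal.under_def, Ideal.mem_comap] at h
      exact h
    rw [map_natCast] at h'
    rw [Nat.cast_mul]
    exact w.asIdeal.mul_mem_left _ h'
  have hgood : (W.baseChange K).HasGoodReductionAt w :=
    hasGoodReductionAt_baseChange_of_hasGoodReductionAt_rat W v w (hasGoodReductionAt_of_natCast_conductorNorm_notMem W v hNv)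
  -- the lift to level `4`
  have h12 : (2 : ℤ) ∣ ((2 ^ 2 : ℕ) : ℤ) := ⟨2, by norm_num⟩
  have h4w : ((((2 ^ 2 : ℕ) : ℤ)) : 𝓞 K) ∉ w.asIdeal := by
    intro h
    have h' : ((2 : ℕ) : 𝓞 K) * ((2 : ℕ) : 𝓞 K) ∈ w.asIdeal := by
      have e : ((((2 ^ 2 : ℕ) : ℤ)) : 𝓞 K) = ((2 : ℕ) : 𝓞 K) * ((2 : ℕ) : 𝓞 K) := by push_cast; norm_num
      rw [← e]; exact h
    rcases w.isPrime.mem_or_mem h' with h2 | h2 <;> exact h2w h2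
  have hιz : ∀ ρ ∈ torsionFixing (W.baseChange K) ((2 ^ 2 : ℕ) : ℤ),
      h1Eval (W.baseChange K) _ (torsionH1OfDvd (W.baseChange K) h12 z) ρ = 0 := by
    have e : ((2 ^ 2 : ℕ) : ℤ) = 4 := by norm_num
    intro ρ hρ
    refine (h1Eval_torsionH1OfDvd_eq_zero_iff (W.baseChange K) h12 z hρ).mpr (hz ρ ?_)
    rw [← e]; exact hρ
  obtain ⟨𝔓, h𝔓⟩ := w.primesAbove_nonempty
  have hι : torsionH1OfDvd (W.baseChange K) h12 z ∈ selmerLocalKer (W.baseChange K) (w.adicCompletion K) ((2 ^ 2 : ℕ) : ℤ) :=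
    (SelmerDescent.mem_selmerLocalKer_iff_forall_h1Eval_eq_zero (W.baseChange K) w hgood h4w h𝔓 _).mpr fun τ hτ ↦
      hιz τ (SelmerDescent.inertia_le_torsionFixing_of_hasGoodReductionAt (W.baseChange K) w hgood h4w h𝔓 hτ)
  exact (RelaxedCount.torsionH1OfDvd_mem_selmerLocalKer_iff_mem (W.baseChange K) h12 (w.adicCompletion K) z).mp hι

/-- **A class of `H¹(K, E_K[2])` dying on `Γ_{K(E_K[4])}` is `2`-Selmer iff it is Kummer at the places over `2N`** (`K` imaginary quadratic; §1 off
`2N`, the complex place). [cite: GrossLMS1991, §6 Prop. 6.2, §7 (7.4)] [cite: SilvermanAEC2009, X.4] -/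
theorem mem_selmerGroup_iff_forall_mem_two_mul (hK : IsImaginaryQuadratic K) {z : galH1Torsion (W.baseChange K) (2 : ℤ)}
    (hz : ∀ ρ ∈ torsionFixing (W.baseChange K) (4 : ℤ), h1Eval (W.baseChange K) (2 : ℤ) z ρ = 0) :
    z ∈ selmerGroup (W.baseChange K) (2 : ℤ) ↔
      ∀ w : HeightOneSpectrum (𝓞 K), ((2 * W.conductorNorm ℤ : ℕ) : 𝓞 K) ∈ w.asIdeal →
        z ∈ selmerLocalKer (W.baseChange K) (w.adicCompletion K) (2 : ℤ) := by
  rw [WeierstrassCurve.mem_selmerGroup_iff]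
  constructor
  · rintro ⟨hfin, -⟩ w _
    exact hfin w
  · intro h
    refine ⟨fun w ↦ ?_, fun w ↦ mem_selmerLocalKer_infinitePlace_of_isImaginaryQuadratic (W := W) hK (2 : ℤ) w z⟩
    by_cases hw : ((2 * W.conductorNorm ℤ : ℕ) : 𝓞 K) ∈ w.asIdeal
    · exact h w hw
    · exact mem_selmerLocalKer_of_forall_torsionFixing_four_of_notMem W w hw hz

/-! ## §2 The dichotomy -/

/-- ★ **`(NPh)` ⟺ THE LAWSON–WUTHRICH CLASS IS NOT `2`-SELMER OVER `K`.**  Frame: `ρ_{E,2^n}` onto over `ℚ` for all `n`; `K` imaginary quadratic,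
`d_K` odd, `d_K·(−|Δ|)`, `d_K·(−2|Δ|)` non-squares (no Heegner hypothesis, no condition at `2` needed).  Then `(NPh_M)(W, K)` holds for every `M ≥ 1`
(every class of `H¹(K, E[2^M])` dying on `Γ_{K(E[2^M])}` and Kummer at all places over `2N_E` is `0`) **iff** for every non-zero `x ∈ H¹(ℚ, E[2])`
dying on `Γ_{ℚ(E[4])}` (there is exactly one: g10's level-`4` class `ξ`), `res_K x ∉ Sel₂(E_K/K)`.  (⟹) the witness place of `…Witness` is one of
the Selmer conditions; (⟸) `res_K ξ ∉ Sel₂` with §1 gives a place `w ∋ 2N` where `res_K ξ` is not Kummer, and by the rigidity of `…KLW` that place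
witnesses every non-zero class dying on `Γ_{K(E[4])}`.  READING: the obstruction to every `(NPh)`-fed Kolyvagin argument at `2` on this route is
EXACTLY «`res_K ξ ∈ Sel₂(E_K)`», i.e. `Sel₂(E_K) → H¹(K(E[4]), E[2])` not injective.  BSD is NOT proved by this.
[cite: LawsonWuthrich2016, §3, §7.1 and §8] [cite: GrossLMS1991, §9 Prop. 9.1] [cite: McCallumLMS1991, §3] -/
theorem nonPhantom_pow_iff_resTorsion_notMem_selmerGroup
    (hρ : ∀ n : ℕ, 0 < n → W.HasSurjectiveModNGaloisRep ((2 : ℤ) ^ n)) (hK : IsImaginaryQuadratic K)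
    (hodd : Odd (NumberField.discr K)) (hnsq₁ : ¬ IsSquare ((NumberField.discr K : ℚ) * -|W.Δ|))
    (hnsq₂ : ¬ IsSquare ((NumberField.discr K : ℚ) * (-(2 * |W.Δ|)))) :
    (∀ (Mlev : ℕ), 1 ≤ Mlev → ∀ z : galH1Torsion (W.baseChange K) ((2 ^ Mlev : ℕ) : ℤ),
        (∀ ρ ∈ torsionFixing (W.baseChange K) ((2 ^ Mlev : ℕ) : ℤ), h1Eval (W.baseChange K) ((2 ^ Mlev : ℕ) : ℤ) z ρ = 0) →
        (∀ w : HeightOneSpectrum (𝓞 K), ((2 * W.conductorNorm ℤ : ℕ) : 𝓞 K) ∈ w.asIdeal →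
          z ∈ selmerLocalKer (W.baseChange K) (w.adicCompletion K) ((2 ^ Mlev : ℕ) : ℤ)) → z = 0) ↔
      ∀ x : galH1Torsion W (2 : ℤ), x ≠ 0 → (∀ h ∈ torsionFixing W (4 : ℤ), h1Eval W (2 : ℤ) x h = 0) →
        resTorsion W K (2 : ℤ) x ∉ selmerGroup (W.baseChange K) (2 : ℤ) := by
  rw [nonPhantom_pow_iff_levelTwoWitness W hρ hK hodd hnsq₁ hnsq₂ (W.conductorNorm ℤ)]
  constructor
  · rintro ⟨w₀, hw₀, hwit⟩ x hx0 hx hSel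
    obtain ⟨hr0, hr⟩ := resTorsion_ne_zero_and_forall_torsionFixing_four W hρ hK hx0 hx
    exact hwit _ hr0 hr (((WeierstrassCurve.mem_selmerGroup_iff _ _ _).mp hSel).1 w₀)
  · intro hnot
    have hsurj4 : W.HasSurjectiveModNGaloisRep 4 := by have h := hρ 2 two_pos; norm_num at h; exact h
    obtain ⟨ξ, hξ0, hξ⟩ := GenusKolyTwistingPrime.exists_ne_zero_forall_torsionFixing_four_h1Eval_eq_zero W hsurj4
    obtain ⟨ha0, ha⟩ := resTorsion_ne_zero_and_forall_torsionFixing_four W hρ hK hξ0 hξ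
    -- `res_K ξ ∉ Sel₂` ⟹ some place over `2N` where it is not Kummer
    have hex : ∃ w₀ : HeightOneSpectrum (𝓞 K), ((2 * W.conductorNorm ℤ : ℕ) : 𝓞 K) ∈ w₀.asIdeal ∧
        resTorsion W K (2 : ℤ) ξ ∉ selmerLocalKer (W.baseChange K) (w₀.adicCompletion K) (2 : ℤ) := by
      by_contra hall
      push Not at hall
      exact hnot ξ hξ0 hξ ((mem_selmerGroup_iff_forall_mem_two_mul W hK ha).mpr hall)
    obtain ⟨w₀, hw₀, hw₀ξ⟩ := hex
    refine ⟨w₀, hw₀, fun z hz0 hz hzw ↦ ?_⟩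
    have hz4 : ∀ ρ ∈ torsionFixing (W.baseChange K) ((2 ^ 2 : ℕ) : ℤ), h1Eval (W.baseChange K) (2 : ℤ) z ρ = 0 := by
      have e : ((2 ^ 2 : ℕ) : ℤ) = 4 := by norm_num
      rw [e]
      exact hz
    rcases eq_zero_or_eq_resTorsion_of_forall_torsionFixing_pow W hρ hK hodd hnsq₁ hnsq₂ hξ0 hξ le_rfl hz4 with h | h
    · exact hz0 h
    · exact hw₀ξ (h ▸ hzw)

end Summit.BirchSwinnertonDyer.BirchSwinnertonDyer.Theorems.GenusExact.Lw2PhantomExclusion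

end
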